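/-
Copyright: the b2b-balaban T⁴-continuum CRUX team, row NE7b, leaf prover `t4-ne7b-formalise-leaf-06` (gen 145), on the OWNER
lineage `t4-ne7b-p1` g105's RULINGS W-ne7bp1-g105-2 (4) («WANTED from you, re-based on p361712 by import: your §3 … and your §5») and
W-ne7bp1-g105-3 (3) («GO STANDS — v2 MINUS §2; `…_cover` fed by MY `translatedLargeFieldMass_le`»), and the refuter's PRICING-NE7b v69
F379 (σ-1 row sums AT `Z`). Project licence.
-/
import Summits.QuantumFields.BalabanUV.T4Continuum.Spine.NE7b.GaussianFibrewiseDecoupling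
import Summits.QuantumFields.BalabanUV.T4Continuum.Spine.NE7b.GaussianTranslatedMass

/-!
# THE SHIFTED FIBRE'S MOMENT FED INTO THE DECOUPLING, AND RESIDUAL (R1″) READ FROM SUP-NORM DATA: the induced-mean energy from
# finite range + far small field + the response map's row sums AT THE PINNED SET, the translated window's mass from the cover
# (row NE7b, node U5c; kernel theorems of real analysis — the first MODEL supplier of (R1″))

Cell `pub-balaban`, sub-cell `t4`, spine estimate NE7b (`T4WeightBudget.RelWeightBound`; the cell's OWN estimate — NOT PRINTED in
[Bałaban 1983–89], NOT PROVED).  Crux-route MODEL work under `Spine/NE7b/` (coordinator ruling e34b3e0c item (2)); NOTHING of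
Bałaban's is named or asserted; no `T4Continuum/Support` leaf typed; no `def`, no `structure`, no `[cite:]`; zero `sorry`.

WHY.  The OWNER's `…NE7b.GaussianFibrewiseDecoupling.restrictedMoment_le_of_shifted_fibres` (residual (R1) → (R1′)) bounds the whole
restricted moment of the coupled two-block Gaussian by a constant `C` as soon as the SHIFTED near-block moment is `≤ C` wherever the far
characteristic function `F₂` is non-zero (its displayed `hfib`); his `…NE7b.GaussianShiftedFibre.shiftedMoment_le_of_inducedMean_le`
((R1′) → (R1″), p361712) prices that shifted moment by completing the square: `C = e^{(1+ε⁻¹)B₀}·(√(1−δ'))⁻¹ ^ r ∕ (1 − η)` once the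
INDUCED-MEAN ENERGY `mᵀQ₁m ≤ B₀` (`m = S₁₁⁻¹S₁₂x₂`) and the TRANSLATED window's large-field mass `≤ η` are displayed — residual (R1″);
his `…NE7b.GaussianTranslatedMass` (p362338) reads that mass from the centred cover and the induced mean's energies in the large-field
forms (`translatedLargeFieldMass_le`, `shiftedMoment_le_of_inducedMeans`: (R1′) is (R1″) ALONE).  THIS FILE (RULINGS W-ne7bp1-g105-2 (4)
and -3 (3): the junction + the consumer-side read, ONE proof per statement) does three things.  §1 JUNCTION: feeds the fibre theorems into
the decoupling — the whole restricted moment is `≤ C` with `B₀`, `η` (or the cover's energies) asked ONLY on `{F₂ ≠ 0}`; the far block's `F₂`,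
`S₂₂` and volume are absent from the constant; also with the response DISPLAYED by `S₁₁ (m x₂) = S₁₂ x₂`.  §2 (R1″-ENERGY READ, refuter
σ-1): `B₀` from sup-norm data — the response map `T = S₁₁⁻¹S₁₂` needs its column support in `N` (finite range) and its row sums
`Σ_{i∈N}|T j i| ≤ t` ONLY FOR ROWS `j` IN THE PINNED SET `Z ⊇ supp Q₁` (the LOCAL letter `t_Z` the buffer makes small — SUPPLIED in the
model by pub-balaban-gaps-ne6's `…GaussianInducedMeanDecay.rowSum_response_le` from the tree's Combes–Thomas estimate; DISPLAYED here), and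
the far field small on `N` where `F₂ ≠ 0` (`|x₂ i| ≤ p`): `B₀ = (p·t)²·Σ_{j,k∈Z}|Q₁ j k|`.  §3 the translated mass with the energies
DISPLAYED as bounds `κ_b` (the OWNER's `translatedLargeFieldMass_le` + monotonicity — an alias-grade corollary, no second proof).  §4 composes.

WHAT IS PROVED ([folklore]; finite sums and the OWNER's four files BY NAME):
* §1 **`restrictedMoment_le_of_inducedMean_le`** (GFD ∘ `shiftedMoment_le_of_inducedMean_le` at `v := S₁₂ x₂`; `hF₂ hA hB` the
  OWNER's, verbatim), `restrictedMoment_le_of_response` (the same with `m`, `hm : S₁₁ (m x₂) = S₁₂ x₂` displayed; `m x₂ = S₁₁⁻¹S₁₂x₂`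
  by `nonsing_inv_mul`), **`restrictedMoment_le_of_inducedMeans`** (GFD ∘ `GaussianTranslatedMass.shiftedMoment_le_of_inducedMeans`:
  the cover's data, `hηb`∕`hB` on `{F₂ ≠ 0}`).
* §2 `abs_mulVec_le_of_support`, `qf_le_of_abs_le_on` (`B` supported on `Z × Z`, `|m j| ≤ ρ` on `Z` ⊢ `mᵀBm ≤ ρ²·Σ_{Z×Z}|B|`),
  **`qf_response_le_on`** (`(T x₂)ᵀB(T x₂) ≤ (p·t)²·Σ_{Z×Z}|B|` from column support `N` and row sums `≤ t` of the rows `j ∈ Z` only).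
* §3 `translatedLargeFieldMass_le_of_energy_le` (`mᵀQ_b m ≤ κ_b` ⊢ mass `≤ Σ_b e^{−(θ_b − (1+ε⁻¹)κ_b)∕(1+ε)}·(√(1−δ))⁻¹^{r_b} · ∫e^{−S}`).
* §4 **`restrictedMoment_le_of_finiteRange_smallField`** (`B₀ := (p·t)²·Σ_{Z×Z}|Q₁|`, `η` displayed) and
  **`restrictedMoment_le_of_finiteRange_smallField_cover`** (`η := Σ_b e^{−(θ_b − (1+ε⁻¹)κ_b)∕(1+ε)}·(√(1−δ''))⁻¹^{r_b}` by §3, the `κ_b`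
  displayed on `{F₂ ≠ 0}` — readable from the same sup-norm data by `qf_response_le_on` with `B := Q_b`).

NOT HERE (honest).  That Bałaban's fluctuation covariances, 𝐑-operations, buffers and small-field conditions SUPPLY `N`, `p`, `t` (at
`Z`), `κ_b` of the right order uniformly in the running coupling is the (A1c) INSTANCE (NC-NE7b-α UNRULED; refuter F379∕F380: the
buffer letter `t_Z`, not the global `‖T‖_{∞→∞}`, is the one the instance can pay) — not claimed; the non-Gaussian remainder (R2); the
two full integrands' integrability stays DISPLAYED as in the OWNER's file.  BY-NAME EFFECT ON THE WALL: NONE.  NE7b NOT PRINTED ∕ NOT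
PROVED; spine PROVED 0∕9; rung (B)+1 on a FINITE torus — NOT infinite volume, NOT the mass gap, NOT Clay.
HONEST DEPENDENCY: continuum YM on T⁴ ⇐ BetaPertH ∧ nine spine estimates (0/9 proved); BetaPertH ⇐ (D1) ∧ (D4) ∧ CAP+tail;
G-an2-4 gates asym, D1 and NE2/3/4.
-/

set_option autoImplicit false

open Matrix Finset MeasureTheory Real
open Summit.QuantumFields.BalabanUV.T4Continuum.NE7b.GaussianFibrewiseDecoupling (restrictedMoment_le_of_shifted_fibres)
open Summit.QuantumFields.BalabanUV.T4Continuum.NE7b.GaussianShiftedFibre (shiftedMoment_le_of_inducedMean_le)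
open Summit.QuantumFields.BalabanUV.T4Continuum.NE7b.GaussianTranslatedMass (translatedLargeFieldMass_le
  shiftedMoment_le_of_inducedMeans)

namespace Summit.QuantumFields.BalabanUV.T4Continuum.NE7b.GaussianShiftedFibreMoment

variable {n₁ n₂ : Type} [Fintype n₁] [Fintype n₂]

/-! ## §1 The junction: the OWNER's decoupling fed by his priced shifted moment -/

section Junction

variable [DecidableEq n₁]

/-- **THE WHOLE RESTRICTED MOMENT FROM THE INDUCED-MEAN ENERGY AND THE TRANSLATED WINDOW's MASS, BOTH ON `{F₂ ≠ 0}` ONLY.**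
Coupled blocks `[[S₁₁, S₁₂], [S₁₂ᵀ, S₂₂]]` with `S₁₁` positive definite; sacrificed form `Q₁ ⊕ 0`, `Q₁` positive semidefinite of rank
`≤ r` with the inflated `(1+ε)Q₁` `δ'`-dominated by `S₁₁` (`0 ≤ δ' < 1`, `ε > 0`); restriction `F₁(x₁)·F₂(x₂)`, `0 ≤ F₁ ≤ 1` measurable,
`F₂ ≥ 0`.  If for every far configuration with `F₂ x₂ ≠ 0` the induced mean `m = S₁₁⁻¹S₁₂x₂` has energy `mᵀQ₁m ≤ B₀` and the translated
window `F₁(· − m)` has large-field mass `≤ η·∫e^{−S₁₁}` (`η < 1`), then the WHOLE numerator is at most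
`e^{(1+ε⁻¹)B₀}·(√(1−δ'))⁻¹ ^ r ∕ (1 − η)` times the WHOLE denominator (`…GaussianFibrewiseDecoupling.restrictedMoment_le_of_shifted_fibres`
∘ `…GaussianShiftedFibre.shiftedMoment_le_of_inducedMean_le`; `hF₂ hA hB` are the OWNER's, verbatim). [folklore] -/
theorem restrictedMoment_le_of_inducedMean_le {S₁₁ Q₁ : Matrix n₁ n₁ ℝ} (S₁₂ : Matrix n₁ n₂ ℝ) (S₂₂ : Matrix n₂ n₂ ℝ)
    {δ' ε η B₀ : ℝ} {r : ℕ} (hS : S₁₁.PosDef) (hQ : Q₁.PosSemidef) (hε : 0 < ε) (hdom : (δ' • S₁₁ - (1 + ε) • Q₁).PosSemidef)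
    (hδ0 : 0 ≤ δ') (hδ : δ' < 1) (hr : Q₁.rank ≤ r) {F₁ : (n₁ → ℝ) → ℝ} (hF0 : ∀ x, 0 ≤ F₁ x) (hF1 : ∀ x, F₁ x ≤ 1)
    (hFm : Measurable F₁) (hη : η < 1) (F₂ : (n₂ → ℝ) → ℝ) (hF₂ : ∀ x₂, 0 ≤ F₂ x₂)
    (hmass : ∀ x₂, F₂ x₂ ≠ 0 →
      ∫ u, (1 - F₁ (u - S₁₁⁻¹ *ᵥ (S₁₂ *ᵥ x₂))) * exp (-(u ⬝ᵥ (S₁₁ *ᵥ u))) ≤ η * ∫ u, exp (-(u ⬝ᵥ (S₁₁ *ᵥ u))))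
    (hB₀ : ∀ x₂, F₂ x₂ ≠ 0 → (S₁₁⁻¹ *ᵥ (S₁₂ *ᵥ x₂)) ⬝ᵥ (Q₁ *ᵥ (S₁₁⁻¹ *ᵥ (S₁₂ *ᵥ x₂))) ≤ B₀)
    (hA : Integrable fun x : n₁ ⊕ n₂ → ℝ => (F₁ (fun i => x (Sum.inl i)) * F₂ (fun i => x (Sum.inr i))) *
      (exp (x ⬝ᵥ (Matrix.fromBlocks Q₁ 0 0 (0 : Matrix n₂ n₂ ℝ) *ᵥ x)) *
        exp (-(x ⬝ᵥ (Matrix.fromBlocks S₁₁ S₁₂ S₁₂ᵀ S₂₂ *ᵥ x)))))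
    (hB : Integrable fun x : n₁ ⊕ n₂ → ℝ => (F₁ (fun i => x (Sum.inl i)) * F₂ (fun i => x (Sum.inr i))) *
      exp (-(x ⬝ᵥ (Matrix.fromBlocks S₁₁ S₁₂ S₁₂ᵀ S₂₂ *ᵥ x)))) :
    ∫ x : n₁ ⊕ n₂ → ℝ, (F₁ (fun i => x (Sum.inl i)) * F₂ (fun i => x (Sum.inr i))) *
        (exp (x ⬝ᵥ (Matrix.fromBlocks Q₁ 0 0 (0 : Matrix n₂ n₂ ℝ) *ᵥ x)) *
          exp (-(x ⬝ᵥ (Matrix.fromBlocks S₁₁ S₁₂ S₁₂ᵀ S₂₂ *ᵥ x)))) ≤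
      (exp ((1 + ε⁻¹) * B₀) * ((√(1 - δ'))⁻¹ ^ r / (1 - η))) *
        ∫ x : n₁ ⊕ n₂ → ℝ, (F₁ (fun i => x (Sum.inl i)) * F₂ (fun i => x (Sum.inr i))) *
          exp (-(x ⬝ᵥ (Matrix.fromBlocks S₁₁ S₁₂ S₁₂ᵀ S₂₂ *ᵥ x))) :=
  restrictedMoment_le_of_shifted_fibres S₁₁ Q₁ S₁₂ S₂₂ F₁ F₂ hF₂ hA hB fun x₂ hx₂ =>
    shiftedMoment_le_of_inducedMean_le hS hQ hε hdom hδ0 hδ hr (S₁₂ *ᵥ x₂) hF0 hF1 hFm hη (hmass x₂ hx₂) (hB₀ x₂ hx₂)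

/-- **THE SAME WITH THE RESPONSE DISPLAYED** by `hm : S₁₁ (m x₂) = S₁₂ x₂` (for positive-definite `S₁₁` this forces
`m x₂ = S₁₁⁻¹S₁₂x₂`): the induced-mean energy and the translated window are read at `m x₂`. [folklore] -/
theorem restrictedMoment_le_of_response {S₁₁ Q₁ : Matrix n₁ n₁ ℝ} (S₁₂ : Matrix n₁ n₂ ℝ) (S₂₂ : Matrix n₂ n₂ ℝ)
    {δ' ε η B₀ : ℝ} {r : ℕ} (hS : S₁₁.PosDef) (hQ : Q₁.PosSemidef) (hε : 0 < ε) (hdom : (δ' • S₁₁ - (1 + ε) • Q₁).PosSemidef)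
    (hδ0 : 0 ≤ δ') (hδ : δ' < 1) (hr : Q₁.rank ≤ r) {F₁ : (n₁ → ℝ) → ℝ} (hF0 : ∀ x, 0 ≤ F₁ x) (hF1 : ∀ x, F₁ x ≤ 1)
    (hFm : Measurable F₁) (hη : η < 1) (F₂ : (n₂ → ℝ) → ℝ) (hF₂ : ∀ x₂, 0 ≤ F₂ x₂) (m : (n₂ → ℝ) → (n₁ → ℝ))
    (hm : ∀ x₂, S₁₁ *ᵥ m x₂ = S₁₂ *ᵥ x₂)
    (hmass : ∀ x₂, F₂ x₂ ≠ 0 →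
      ∫ u, (1 - F₁ (u - m x₂)) * exp (-(u ⬝ᵥ (S₁₁ *ᵥ u))) ≤ η * ∫ u, exp (-(u ⬝ᵥ (S₁₁ *ᵥ u))))
    (hB₀ : ∀ x₂, F₂ x₂ ≠ 0 → m x₂ ⬝ᵥ (Q₁ *ᵥ m x₂) ≤ B₀)
    (hA : Integrable fun x : n₁ ⊕ n₂ → ℝ => (F₁ (fun i => x (Sum.inl i)) * F₂ (fun i => x (Sum.inr i))) *
      (exp (x ⬝ᵥ (Matrix.fromBlocks Q₁ 0 0 (0 : Matrix n₂ n₂ ℝ) *ᵥ x)) *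
        exp (-(x ⬝ᵥ (Matrix.fromBlocks S₁₁ S₁₂ S₁₂ᵀ S₂₂ *ᵥ x)))))
    (hB : Integrable fun x : n₁ ⊕ n₂ → ℝ => (F₁ (fun i => x (Sum.inl i)) * F₂ (fun i => x (Sum.inr i))) *
      exp (-(x ⬝ᵥ (Matrix.fromBlocks S₁₁ S₁₂ S₁₂ᵀ S₂₂ *ᵥ x)))) :
    ∫ x : n₁ ⊕ n₂ → ℝ, (F₁ (fun i => x (Sum.inl i)) * F₂ (fun i => x (Sum.inr i))) *
        (exp (x ⬝ᵥ (Matrix.fromBlocks Q₁ 0 0 (0 : Matrix n₂ n₂ ℝ) *ᵥ x)) *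
          exp (-(x ⬝ᵥ (Matrix.fromBlocks S₁₁ S₁₂ S₁₂ᵀ S₂₂ *ᵥ x)))) ≤
      (exp ((1 + ε⁻¹) * B₀) * ((√(1 - δ'))⁻¹ ^ r / (1 - η))) *
        ∫ x : n₁ ⊕ n₂ → ℝ, (F₁ (fun i => x (Sum.inl i)) * F₂ (fun i => x (Sum.inr i))) *
          exp (-(x ⬝ᵥ (Matrix.fromBlocks S₁₁ S₁₂ S₁₂ᵀ S₂₂ *ᵥ x))) := by
  have hdet : IsUnit S₁₁.det := isUnit_iff_ne_zero.2 hS.det_pos.ne'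
  have em : ∀ x₂, S₁₁⁻¹ *ᵥ (S₁₂ *ᵥ x₂) = m x₂ := fun x₂ => by
    rw [← hm x₂, mulVec_mulVec, nonsing_inv_mul _ hdet, one_mulVec]
  refine restrictedMoment_le_of_inducedMean_le S₁₂ S₂₂ hS hQ hε hdom hδ0 hδ hr hF0 hF1 hFm hη F₂ hF₂ (fun x₂ hx₂ => ?_)
    (fun x₂ hx₂ => ?_) hA hB
  · rw [em]; exact hmass x₂ hx₂
  · rw [em]; exact hB₀ x₂ hx₂

/-- **THE SAME WITH THE TRANSLATED WINDOW READ FROM THE COVER** (`…GaussianFibrewiseDecoupling.restrictedMoment_le_of_shifted_fibres`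
∘ `…GaussianTranslatedMass.shiftedMoment_le_of_inducedMeans`): the OWNER's centred cover of `1 − F₁` by large-field events
`{θ_b ≤ xᵀQ_b x}` (`Q_b` positive semidefinite, `δ`-dominated, rank `≤ r_b`) and, ON `{F₂ ≠ 0}` ONLY, the induced mean's energies —
in the sacrificed form (`≤ B₀`) and in the window forms (the shrunk-threshold sum `≤ η < 1`). [folklore] -/
theorem restrictedMoment_le_of_inducedMeans {S₁₁ Q₁ : Matrix n₁ n₁ ℝ} (S₁₂ : Matrix n₁ n₂ ℝ) (S₂₂ : Matrix n₂ n₂ ℝ)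
    {ι : Type*} (Bs : Finset ι) (Qb : ι → Matrix n₁ n₁ ℝ) (θ : ι → ℝ) (rb : ι → ℕ) {δ δ' ε η B₀ : ℝ} {r : ℕ}
    (hS : S₁₁.PosDef) (hQ : Q₁.PosSemidef) (hε : 0 < ε) (hdom : (δ' • S₁₁ - (1 + ε) • Q₁).PosSemidef) (hδ'0 : 0 ≤ δ')
    (hδ' : δ' < 1) (hr : Q₁.rank ≤ r) (hQb : ∀ b ∈ Bs, (Qb b).PosSemidef) (hdomb : ∀ b ∈ Bs, (δ • S₁₁ - Qb b).PosSemidef)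
    (hδ0 : 0 ≤ δ) (hδ : δ < 1) (hrb : ∀ b ∈ Bs, (Qb b).rank ≤ rb b) {F₁ : (n₁ → ℝ) → ℝ} (hF0 : ∀ x, 0 ≤ F₁ x)
    (hF1 : ∀ x, F₁ x ≤ 1) (hFm : Measurable F₁)
    (hcov : ∀ x, 1 - F₁ x ≤ ∑ b ∈ Bs, Set.indicator {x : n₁ → ℝ | θ b ≤ x ⬝ᵥ (Qb b *ᵥ x)} (fun _ => (1 : ℝ)) x) (hη : η < 1)
    (F₂ : (n₂ → ℝ) → ℝ) (hF₂ : ∀ x₂, 0 ≤ F₂ x₂)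
    (hηb : ∀ x₂, F₂ x₂ ≠ 0 → ∑ b ∈ Bs, exp (-((θ b - (1 + ε⁻¹) *
        ((S₁₁⁻¹ *ᵥ (S₁₂ *ᵥ x₂)) ⬝ᵥ (Qb b *ᵥ (S₁₁⁻¹ *ᵥ (S₁₂ *ᵥ x₂))))) / (1 + ε))) * (√(1 - δ))⁻¹ ^ rb b ≤ η)
    (hB₀ : ∀ x₂, F₂ x₂ ≠ 0 → (S₁₁⁻¹ *ᵥ (S₁₂ *ᵥ x₂)) ⬝ᵥ (Q₁ *ᵥ (S₁₁⁻¹ *ᵥ (S₁₂ *ᵥ x₂))) ≤ B₀)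
    (hA : Integrable fun x : n₁ ⊕ n₂ → ℝ => (F₁ (fun i => x (Sum.inl i)) * F₂ (fun i => x (Sum.inr i))) *
      (exp (x ⬝ᵥ (Matrix.fromBlocks Q₁ 0 0 (0 : Matrix n₂ n₂ ℝ) *ᵥ x)) *
        exp (-(x ⬝ᵥ (Matrix.fromBlocks S₁₁ S₁₂ S₁₂ᵀ S₂₂ *ᵥ x)))))
    (hB : Integrable fun x : n₁ ⊕ n₂ → ℝ => (F₁ (fun i => x (Sum.inl i)) * F₂ (fun i => x (Sum.inr i))) *
      exp (-(x ⬝ᵥ (Matrix.fromBlocks S₁₁ S₁₂ S₁₂ᵀ S₂₂ *ᵥ x)))) :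
    ∫ x : n₁ ⊕ n₂ → ℝ, (F₁ (fun i => x (Sum.inl i)) * F₂ (fun i => x (Sum.inr i))) *
        (exp (x ⬝ᵥ (Matrix.fromBlocks Q₁ 0 0 (0 : Matrix n₂ n₂ ℝ) *ᵥ x)) *
          exp (-(x ⬝ᵥ (Matrix.fromBlocks S₁₁ S₁₂ S₁₂ᵀ S₂₂ *ᵥ x)))) ≤
      (exp ((1 + ε⁻¹) * B₀) * ((√(1 - δ'))⁻¹ ^ r / (1 - η))) *
        ∫ x : n₁ ⊕ n₂ → ℝ, (F₁ (fun i => x (Sum.inl i)) * F₂ (fun i => x (Sum.inr i))) *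
          exp (-(x ⬝ᵥ (Matrix.fromBlocks S₁₁ S₁₂ S₁₂ᵀ S₂₂ *ᵥ x))) :=
  restrictedMoment_le_of_shifted_fibres S₁₁ Q₁ S₁₂ S₂₂ F₁ F₂ hF₂ hA hB fun x₂ hx₂ =>
    shiftedMoment_le_of_inducedMeans Bs Qb θ rb hS hQ hε hdom hδ'0 hδ' hr hQb hdomb hδ0 hδ hrb (S₁₂ *ᵥ x₂) hF0 hF1 hFm hcov
      hη (hηb x₂ hx₂) (hB₀ x₂ hx₂)

end Junction


/-! ## §2 (R1″-energy read) The induced-mean energy from finite range + far small field + row sums AT THE PINNED SET (refuter σ-1) -/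

omit [Fintype n₁] in
/-- **A SUP-NORM BOUND ON `(T x₂) j` FROM THE COLUMN SUPPORT OF ROW `j`.**  If `T j i = 0` off `N` and `|x₂ i| ≤ p` on `N`, then
`|(T x₂) j| ≤ p · Σ_{i ∈ N} |T j i|`. [folklore] -/
theorem abs_mulVec_le_of_support (T : Matrix n₁ n₂ ℝ) (N : Finset n₂) (j : n₁) (hT : ∀ i, i ∉ N → T j i = 0)
    {x₂ : n₂ → ℝ} {p : ℝ} (hx : ∀ i ∈ N, |x₂ i| ≤ p) :
    |(T *ᵥ x₂) j| ≤ p * ∑ i ∈ N, |T j i| := by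
  have hz : (T *ᵥ x₂) j = ∑ i ∈ N, T j i * x₂ i := by
    simp only [Matrix.mulVec, dotProduct]
    exact (Finset.sum_subset (Finset.subset_univ N) fun i _ hi => by rw [hT i hi, zero_mul]).symm
  rw [hz]
  calc |∑ i ∈ N, T j i * x₂ i| ≤ ∑ i ∈ N, |T j i * x₂ i| := Finset.abs_sum_le_sum_abs _ _
    _ = ∑ i ∈ N, |T j i| * |x₂ i| := by simp_rw [abs_mul]
    _ ≤ ∑ i ∈ N, |T j i| * p := Finset.sum_le_sum fun i hi => mul_le_mul_of_nonneg_left (hx i hi) (abs_nonneg _)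
    _ = p * ∑ i ∈ N, |T j i| := by rw [← Finset.sum_mul, mul_comm]

/-- **A QUADRATIC FORM SUPPORTED ON `Z × Z` UNDER A SUP-NORM BOUND ON `Z`**: if `B j k = 0` unless `j, k ∈ Z` and `|m j| ≤ ρ` for
`j ∈ Z`, then `mᵀBm ≤ ρ²·Σ_{j∈Z}Σ_{k∈Z}|B j k|` — no coordinate of `m` off the pinned set is seen. [folklore] -/
theorem qf_le_of_abs_le_on (B : Matrix n₁ n₁ ℝ) (Z : Finset n₁) (hBZ : ∀ j k, B j k ≠ 0 → j ∈ Z ∧ k ∈ Z) {m : n₁ → ℝ}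
    {ρ : ℝ} (hm : ∀ j ∈ Z, |m j| ≤ ρ) :
    m ⬝ᵥ (B *ᵥ m) ≤ ρ ^ 2 * ∑ j ∈ Z, ∑ k ∈ Z, |B j k| := by
  -- the double sum over all indices equals the double sum over `Z × Z`
  have hterm : ∀ j k, ¬(j ∈ Z ∧ k ∈ Z) → m j * (B j k * m k) = 0 := fun j k hjk => by
    rw [show B j k = 0 from not_not.1 (mt (hBZ j k) hjk), zero_mul, mul_zero]
  have e : m ⬝ᵥ (B *ᵥ m) = ∑ j ∈ Z, ∑ k ∈ Z, m j * (B j k * m k) := by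
    simp only [dotProduct, Matrix.mulVec, Finset.mul_sum]
    rw [← Finset.sum_subset (Finset.subset_univ Z) fun j _ hj =>
      Finset.sum_eq_zero fun k _ => hterm j k fun h => hj h.1]
    exact Finset.sum_congr rfl fun j _ =>
      (Finset.sum_subset (Finset.subset_univ Z) fun k _ hk => hterm j k fun h => hk h.2).symm
  rw [e, Finset.mul_sum]
  refine Finset.sum_le_sum fun j hj => ?_
  rw [Finset.mul_sum]
  refine Finset.sum_le_sum fun k hk => ?_
  have hρ : 0 ≤ ρ := (abs_nonneg _).trans (hm j hj)
  calc m j * (B j k * m k) ≤ |m j * (B j k * m k)| := le_abs_self _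
    _ = |m j| * (|B j k| * |m k|) := by rw [abs_mul, abs_mul]
    _ ≤ ρ * (|B j k| * ρ) :=
        mul_le_mul (hm j hj) (mul_le_mul_of_nonneg_left (hm k hk) (abs_nonneg _)) (by positivity) hρ
    _ = ρ ^ 2 * |B j k| := by ring

/-- **THE INDUCED-MEAN ENERGY FROM FINITE RANGE + FAR SMALL FIELD + ROW SUMS AT THE PINNED SET.**  `B` supported on `Z × Z`; the
response map `T` has, FOR ITS ROWS `j ∈ Z` ONLY, column support in `N` and row sums `Σ_{i∈N}|T j i| ≤ t`; the far field is small on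
`N` (`|x₂ i| ≤ p`, `0 ≤ p`).  Then `(T x₂)ᵀ B (T x₂) ≤ (p·t)²·Σ_{j,k∈Z}|B j k|`. [folklore] -/
theorem qf_response_le_on (T : Matrix n₁ n₂ ℝ) (B : Matrix n₁ n₁ ℝ) (Z : Finset n₁) (N : Finset n₂)
    (hBZ : ∀ j k, B j k ≠ 0 → j ∈ Z ∧ k ∈ Z) (hTN : ∀ j ∈ Z, ∀ i, i ∉ N → T j i = 0) {p t : ℝ} (hp : 0 ≤ p)
    (hrow : ∀ j ∈ Z, ∑ i ∈ N, |T j i| ≤ t) {x₂ : n₂ → ℝ} (hx : ∀ i ∈ N, |x₂ i| ≤ p) :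
    (T *ᵥ x₂) ⬝ᵥ (B *ᵥ (T *ᵥ x₂)) ≤ (p * t) ^ 2 * ∑ j ∈ Z, ∑ k ∈ Z, |B j k| :=
  qf_le_of_abs_le_on B Z hBZ fun j hj =>
    (abs_mulVec_le_of_support T N j (hTN j hj) hx).trans ((mul_le_mul_of_nonneg_left (hrow j hj) hp).trans_eq (by ring))

/-! ## §3 The translated window's mass with the energies displayed as bounds (the OWNER's lemma + monotonicity) -/

section Window

variable [DecidableEq n₁]

/-- **THE TRANSLATED WINDOW's MASS UNDER ENERGY BOUNDS** — the OWNER's `…GaussianTranslatedMass.translatedLargeFieldMass_le` (cover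
transported to shrunk thresholds at the exact energies `mᵀQ_b m`) followed by monotonicity in displayed bounds `mᵀQ_b m ≤ κ_b`:
`∫ (1 − F₁(u−m))·e^{−uᵀSu} ≤ (Σ_b e^{−(θ_b − (1+ε⁻¹)κ_b)∕(1+ε)}·(√(1−δ))⁻¹^{r_b}) · ∫ e^{−uᵀSu}` — the `η` of §1, uniform over every
exterior whose energies obey the `κ_b`. (An alias-grade corollary; no second proof of the transport.) [folklore] -/
theorem translatedLargeFieldMass_le_of_energy_le {ι : Type*} (Bs : Finset ι) {S : Matrix n₁ n₁ ℝ} (Qb : ι → Matrix n₁ n₁ ℝ)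
    (θ : ι → ℝ) (rb : ι → ℕ) (κb : ι → ℝ) {δ ε : ℝ} (hS : S.PosDef) (hQ : ∀ b ∈ Bs, (Qb b).PosSemidef)
    (hdom : ∀ b ∈ Bs, (δ • S - Qb b).PosSemidef) (hδ0 : 0 ≤ δ) (hδ : δ < 1) (hr : ∀ b ∈ Bs, (Qb b).rank ≤ rb b)
    (hε : 0 < ε) {F₁ : (n₁ → ℝ) → ℝ} (hF1 : ∀ x, F₁ x ≤ 1)
    (hcov : ∀ x, 1 - F₁ x ≤ ∑ b ∈ Bs, Set.indicator {x : n₁ → ℝ | θ b ≤ x ⬝ᵥ (Qb b *ᵥ x)} (fun _ => (1 : ℝ)) x)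
    (m : n₁ → ℝ) (hκ : ∀ b ∈ Bs, m ⬝ᵥ (Qb b *ᵥ m) ≤ κb b) :
    ∫ u, (1 - F₁ (u - m)) * exp (-(u ⬝ᵥ (S *ᵥ u))) ≤
      (∑ b ∈ Bs, exp (-((θ b - (1 + ε⁻¹) * κb b) / (1 + ε))) * (√(1 - δ))⁻¹ ^ rb b) * ∫ u, exp (-(u ⬝ᵥ (S *ᵥ u))) := by
  refine (translatedLargeFieldMass_le Bs Qb θ rb hS hQ hdom hδ0 hδ hr hε hF1 hcov m).trans ?_
  refine mul_le_mul_of_nonneg_right (Finset.sum_le_sum fun b hb => ?_) (integral_nonneg fun u => (exp_pos _).le)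
  refine mul_le_mul_of_nonneg_right (exp_le_exp.2 (neg_le_neg ?_)) (by positivity)
  have h1 : (0 : ℝ) < 1 + ε := by linarith
  rw [div_eq_mul_inv, div_eq_mul_inv]
  refine mul_le_mul_of_nonneg_right ?_ (inv_nonneg.2 h1.le)
  have h2 := mul_le_mul_of_nonneg_left (hκ b hb) (by positivity : (0 : ℝ) ≤ 1 + ε⁻¹)
  linarith

end Window

/-! ## §4 Composed: the whole restricted moment from sup-norm data -/

section Composed

variable [DecidableEq n₁]

/-- **COMPOSED — FINITE RANGE + FAR SMALL FIELD + ROW SUMS AT THE PINNED SET.**  §1 with the induced mean `S₁₁⁻¹S₁₂x₂ = (S₁₁⁻¹S₁₂)x₂`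
and `B₀ := (p·t)²·Σ_{j,k∈Z}|Q₁ j k|` read by §3 from: `Q₁` supported on `Z × Z`; the response map `S₁₁⁻¹S₁₂` with, for its rows in `Z`,
column support in `N` (finite range, DISPLAYED) and row sums `≤ t` (the buffer letter — print: random-walk expansion ∕ maximum
principle — DISPLAYED); the far field small on `N` wherever `F₂ ≠ 0`.  The translated window's mass `η` stays displayed here
(see `…_cover`). [folklore] -/
theorem restrictedMoment_le_of_finiteRange_smallField {S₁₁ Q₁ : Matrix n₁ n₁ ℝ} (S₁₂ : Matrix n₁ n₂ ℝ) (S₂₂ : Matrix n₂ n₂ ℝ)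
    {δ' ε η p t : ℝ} {r : ℕ} (hS : S₁₁.PosDef) (hQ : Q₁.PosSemidef) (hε : 0 < ε)
    (hdom : (δ' • S₁₁ - (1 + ε) • Q₁).PosSemidef) (hδ0 : 0 ≤ δ') (hδ : δ' < 1) (hr : Q₁.rank ≤ r) {F₁ : (n₁ → ℝ) → ℝ}
    (hF0 : ∀ x, 0 ≤ F₁ x) (hF1 : ∀ x, F₁ x ≤ 1) (hFm : Measurable F₁) (hη : η < 1) (F₂ : (n₂ → ℝ) → ℝ)
    (hF₂ : ∀ x₂, 0 ≤ F₂ x₂) (Z : Finset n₁) (N : Finset n₂) (hQZ : ∀ j k, Q₁ j k ≠ 0 → j ∈ Z ∧ k ∈ Z)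
    (hTN : ∀ j ∈ Z, ∀ i, i ∉ N → (S₁₁⁻¹ * S₁₂) j i = 0) (hp : 0 ≤ p) (hrow : ∀ j ∈ Z, ∑ i ∈ N, |(S₁₁⁻¹ * S₁₂) j i| ≤ t)
    (hsmall : ∀ x₂, F₂ x₂ ≠ 0 → ∀ i ∈ N, |x₂ i| ≤ p)
    (hmass : ∀ x₂, F₂ x₂ ≠ 0 →
      ∫ u, (1 - F₁ (u - S₁₁⁻¹ *ᵥ (S₁₂ *ᵥ x₂))) * exp (-(u ⬝ᵥ (S₁₁ *ᵥ u))) ≤ η * ∫ u, exp (-(u ⬝ᵥ (S₁₁ *ᵥ u))))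
    (hA : Integrable fun x : n₁ ⊕ n₂ → ℝ => (F₁ (fun i => x (Sum.inl i)) * F₂ (fun i => x (Sum.inr i))) *
      (exp (x ⬝ᵥ (Matrix.fromBlocks Q₁ 0 0 (0 : Matrix n₂ n₂ ℝ) *ᵥ x)) *
        exp (-(x ⬝ᵥ (Matrix.fromBlocks S₁₁ S₁₂ S₁₂ᵀ S₂₂ *ᵥ x)))))
    (hB : Integrable fun x : n₁ ⊕ n₂ → ℝ => (F₁ (fun i => x (Sum.inl i)) * F₂ (fun i => x (Sum.inr i))) *
      exp (-(x ⬝ᵥ (Matrix.fromBlocks S₁₁ S₁₂ S₁₂ᵀ S₂₂ *ᵥ x)))) :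
    ∫ x : n₁ ⊕ n₂ → ℝ, (F₁ (fun i => x (Sum.inl i)) * F₂ (fun i => x (Sum.inr i))) *
        (exp (x ⬝ᵥ (Matrix.fromBlocks Q₁ 0 0 (0 : Matrix n₂ n₂ ℝ) *ᵥ x)) *
          exp (-(x ⬝ᵥ (Matrix.fromBlocks S₁₁ S₁₂ S₁₂ᵀ S₂₂ *ᵥ x)))) ≤
      (exp ((1 + ε⁻¹) * ((p * t) ^ 2 * ∑ j ∈ Z, ∑ k ∈ Z, |Q₁ j k|)) * ((√(1 - δ'))⁻¹ ^ r / (1 - η))) *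
        ∫ x : n₁ ⊕ n₂ → ℝ, (F₁ (fun i => x (Sum.inl i)) * F₂ (fun i => x (Sum.inr i))) *
          exp (-(x ⬝ᵥ (Matrix.fromBlocks S₁₁ S₁₂ S₁₂ᵀ S₂₂ *ᵥ x))) :=
  restrictedMoment_le_of_inducedMean_le S₁₂ S₂₂ hS hQ hε hdom hδ0 hδ hr hF0 hF1 hFm hη F₂ hF₂ hmass
    (fun x₂ hx₂ => by
      rw [mulVec_mulVec]
      exact qf_response_le_on (S₁₁⁻¹ * S₁₂) Q₁ Z N hQZ hTN hp hrow (hsmall x₂ hx₂)) hA hB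

/-- **COMPOSED WITH THE COVER**: as `restrictedMoment_le_of_finiteRange_smallField`, with the translated window's mass READ by §3 from
the OWNER's centred cover of `1 − F₁` and bounds `κ_b` on the induced mean's energy in each large-field form on `{F₂ ≠ 0}` (the `κ_b`
are readable from the same sup-norm data by `qf_response_le_on` with `B := Q_b` when the `Q_b` live on `Z`);
`η := Σ_b e^{−(θ_b − (1+ε⁻¹)κ_b)∕(1+ε)}·(√(1−δ''))⁻¹^{r_b} < 1` displayed. [folklore] -/
theorem restrictedMoment_le_of_finiteRange_smallField_cover {S₁₁ Q₁ : Matrix n₁ n₁ ℝ} (S₁₂ : Matrix n₁ n₂ ℝ)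
    (S₂₂ : Matrix n₂ n₂ ℝ) {δ' ε p t : ℝ} {r : ℕ} (hS : S₁₁.PosDef) (hQ : Q₁.PosSemidef) (hε : 0 < ε)
    (hdom : (δ' • S₁₁ - (1 + ε) • Q₁).PosSemidef) (hδ0 : 0 ≤ δ') (hδ : δ' < 1) (hr : Q₁.rank ≤ r) {F₁ : (n₁ → ℝ) → ℝ}
    (hF0 : ∀ x, 0 ≤ F₁ x) (hF1 : ∀ x, F₁ x ≤ 1) (hFm : Measurable F₁) (F₂ : (n₂ → ℝ) → ℝ) (hF₂ : ∀ x₂, 0 ≤ F₂ x₂)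
    (Z : Finset n₁) (N : Finset n₂) (hQZ : ∀ j k, Q₁ j k ≠ 0 → j ∈ Z ∧ k ∈ Z)
    (hTN : ∀ j ∈ Z, ∀ i, i ∉ N → (S₁₁⁻¹ * S₁₂) j i = 0) (hp : 0 ≤ p) (hrow : ∀ j ∈ Z, ∑ i ∈ N, |(S₁₁⁻¹ * S₁₂) j i| ≤ t)
    (hsmall : ∀ x₂, F₂ x₂ ≠ 0 → ∀ i ∈ N, |x₂ i| ≤ p)
    {ι : Type*} (Bs : Finset ι) (Qb : ι → Matrix n₁ n₁ ℝ) (θ : ι → ℝ) (rb : ι → ℕ) (κb : ι → ℝ) {δ'' : ℝ}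
    (hQb : ∀ b ∈ Bs, (Qb b).PosSemidef) (hdomb : ∀ b ∈ Bs, (δ'' • S₁₁ - Qb b).PosSemidef) (hδ''0 : 0 ≤ δ'') (hδ'' : δ'' < 1)
    (hrb : ∀ b ∈ Bs, (Qb b).rank ≤ rb b)
    (hcov : ∀ x, 1 - F₁ x ≤ ∑ b ∈ Bs, Set.indicator {x : n₁ → ℝ | θ b ≤ x ⬝ᵥ (Qb b *ᵥ x)} (fun _ => (1 : ℝ)) x)
    (hκb : ∀ x₂, F₂ x₂ ≠ 0 → ∀ b ∈ Bs, (S₁₁⁻¹ *ᵥ (S₁₂ *ᵥ x₂)) ⬝ᵥ (Qb b *ᵥ (S₁₁⁻¹ *ᵥ (S₁₂ *ᵥ x₂))) ≤ κb b)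
    (hη : (∑ b ∈ Bs, exp (-((θ b - (1 + ε⁻¹) * κb b) / (1 + ε))) * (√(1 - δ''))⁻¹ ^ rb b) < 1)
    (hA : Integrable fun x : n₁ ⊕ n₂ → ℝ => (F₁ (fun i => x (Sum.inl i)) * F₂ (fun i => x (Sum.inr i))) *
      (exp (x ⬝ᵥ (Matrix.fromBlocks Q₁ 0 0 (0 : Matrix n₂ n₂ ℝ) *ᵥ x)) *
        exp (-(x ⬝ᵥ (Matrix.fromBlocks S₁₁ S₁₂ S₁₂ᵀ S₂₂ *ᵥ x)))))
    (hB : Integrable fun x : n₁ ⊕ n₂ → ℝ => (F₁ (fun i => x (Sum.inl i)) * F₂ (fun i => x (Sum.inr i))) *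
      exp (-(x ⬝ᵥ (Matrix.fromBlocks S₁₁ S₁₂ S₁₂ᵀ S₂₂ *ᵥ x)))) :
    ∫ x : n₁ ⊕ n₂ → ℝ, (F₁ (fun i => x (Sum.inl i)) * F₂ (fun i => x (Sum.inr i))) *
        (exp (x ⬝ᵥ (Matrix.fromBlocks Q₁ 0 0 (0 : Matrix n₂ n₂ ℝ) *ᵥ x)) *
          exp (-(x ⬝ᵥ (Matrix.fromBlocks S₁₁ S₁₂ S₁₂ᵀ S₂₂ *ᵥ x)))) ≤
      (exp ((1 + ε⁻¹) * ((p * t) ^ 2 * ∑ j ∈ Z, ∑ k ∈ Z, |Q₁ j k|)) * ((√(1 - δ'))⁻¹ ^ r /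
          (1 - ∑ b ∈ Bs, exp (-((θ b - (1 + ε⁻¹) * κb b) / (1 + ε))) * (√(1 - δ''))⁻¹ ^ rb b))) *
        ∫ x : n₁ ⊕ n₂ → ℝ, (F₁ (fun i => x (Sum.inl i)) * F₂ (fun i => x (Sum.inr i))) *
          exp (-(x ⬝ᵥ (Matrix.fromBlocks S₁₁ S₁₂ S₁₂ᵀ S₂₂ *ᵥ x))) :=
  restrictedMoment_le_of_finiteRange_smallField S₁₂ S₂₂ hS hQ hε hdom hδ0 hδ hr hF0 hF1 hFm hη F₂ hF₂ Z N hQZ hTN hp hrow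
    hsmall (fun x₂ hx₂ => translatedLargeFieldMass_le_of_energy_le Bs Qb θ rb κb hS hQb hdomb hδ''0 hδ'' hrb hε hF1 hcov
      (S₁₁⁻¹ *ᵥ (S₁₂ *ᵥ x₂)) (hκb x₂ hx₂)) hA hB

end Composed

end Summit.QuantumFields.BalabanUV.T4Continuum.NE7b.GaussianShiftedFibreMoment
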